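import Summits.PneNP.Statement
import Literature.Computability.Complexity.ClayProblem
import Literature.Computability.MetaComplexity.UniversalMachine
import Literature.Computability.Cryptography.CryptoFoundationsKolmogorov

/-!
# PneNP / ktlang — assembly

Route `PneNP/ktlang`, item `stmt-PneNP-0048` (assembly): if for every efficient universal
machine `U` some `K^t` threshold language `MK^tP[s]` (polynomial `t`, `s`) is not in `P`, then
`P ≠ NP` — given, as hypotheses, the two model bridges `Literature.PNP.P Bool = CplxCore.P`,
`Literature.PNP.NP Bool = CplxCore.NP`, the construction fact `Nonempty UniversalMachine`
(Hennie–Stearns) and the sanity fact `MK^tP[s] ∈ NP` (Liu–Pass 2020, §2.2). Elementary glue.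
-/

namespace Literature.CplxMeta

/-- Settles `stmt-PneNP-0048` (assembly of route ktlang): pick `U` from `nonempty`, take the
`(t, s)` given by the thesis, `MK^tP[s] ∈ NP` by the sanity fact and `∉ P` by the thesis; the
model bridges turn `CplxCore.P ≠ CplxCore.NP` into `PneNP`. [folklore] -/
theorem ktlang_assembly :
    Literature.Computability.Complexity.P_bool_eq → Literature.Computability.Complexity.NP_bool_eq → Literature.Computability.MetaComplexity.UniversalMachine.nonempty →
      Literature.Computability.Cryptography.MKtimeP_mem_NP →
      (∀ U : Literature.Computability.MetaComplexity.UniversalMachine, ∃ (t s : Polynomial ℕ),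
        U.MKtimeP (fun n => t.eval n) (fun n => s.eval n) ∉ Literature.Computability.Complexity.Classes.P) → PneNP := by
  intro hP hNP hne hmem hX
  obtain ⟨U⟩ := hne
  obtain ⟨t, s, h⟩ := hX U
  show ∃ L, L ∈ Literature.Computability.Complexity.PNPWave0.NP Bool ∧ L ∉ Literature.Computability.Complexity.PNPWave0.P Bool
  refine ⟨U.MKtimeP (fun n => t.eval n) (fun n => s.eval n), ?_, ?_⟩
  · rw [show Literature.Computability.Complexity.PNPWave0.NP Bool = _ from hNP]; exact hmem U t s
  · rw [show Literature.Computability.Complexity.PNPWave0.P Bool = _ from hP]; exact h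

end Literature.CplxMeta
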